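import Mathlib.Tactic.Abel
import Summits.MatrixMultiplication.OmegaCensus.DihedralLawModOneTwoCosets
import Summits.MatrixMultiplication.OmegaCensus.NearTilingPeriodic
import Summits.MatrixMultiplication.OmegaCensus.TPPSaturation
import HarnessLib

/-!
# Dicyclic type (`c₀ ≠ 0`): a two-two law triple forces `A/⟨c₀⟩` cyclic

ω-census, family (b3).  Framing: lottery ticket; floor = certified bounds/negative ranges.

Refinement of `DihedralLawModOneTwoCosets.lean` for dihedral-like groups `G(A, c₀)` with `c₀ ≠ 0` (dicyclic type).
There, a TPP triple with `|S| = |T| = 2` attaining the mod-one law `3|S||T||U| + 8 = 8|A|` forces `A` to be two cosets of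
a cyclic subgroup.  Here: with `c₀ ≠ 0` the big set `U` is `c₀`-PERIODIC (`parts_periodic_of_two_two_law`,
`TPPSaturation.lean`), so the near-tiling by translates of its parts is periodic and `near_tiling_two_periodic`
(`NearTilingPeriodic.lean`) upgrades the conclusion to **`A = ⟨g⟩ ∪ (c₀ + ⟨g⟩)`, i.e. `A/⟨c₀⟩` is cyclic**
(`quot_cyclic_of_two_two_law`); the balanced shape `(1,1 | 1,1 | q,q)` cannot occur at all (a periodic set has even
size, `3q + 1 = |A|` is even).  The proofs of `quot_cyclic_of_law_shape_two` / `quot_cyclic_of_two_two_law` are those of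
`two_cosets_of_law_shape_two` / `two_cosets_of_two_two_law` verbatim with the periodic near-tiling lemma at the end.
Used by `DicyclicLawQuotientCyclic.lean` (with the shape-B companion) to classify the dicyclic-type groups attaining the
law: e.g. `C₂ × Q₁₆ = G(ℤ₂ × ℤ₈, (0,4))` — `A/⟨c₀⟩ = ℤ₂ × ℤ₄` not cyclic — attains no law triple.
-/

namespace Summit.MatrixMultiplication.OmegaCensus

open Literature.Combinatorics.Additive Finset

section DihedralLike

variable {A : Type*} [AddCommGroup A] [DecidableEq A] [Fintype A] {G : Type} [Group G] [DecidableEq G]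
  {ρ τ : A → G} {c₀ : A} {S T U : Finset G}

omit [Fintype A] in
/-- A triple sumset `{a} + {b} + X` inherits `c₀`-periodicity from `X`. [folklore] -/
theorem sumset₃_single_single_periodic (a b : A) {X : Finset A} {c₀ : A} (hX : X.image (· + c₀) = X) :
    ((({a} : Finset A) ×ˢ ({b} : Finset A) ×ˢ X).image (fun p : A × A × A => p.1 + p.2.1 + p.2.2)).image
        (fun x => x + c₀) =
      (({a} : Finset A) ×ˢ ({b} : Finset A) ×ˢ X).image (fun p : A × A × A => p.1 + p.2.1 + p.2.2) := by
  apply eq_of_subset_of_card_le _ (by rw [card_image_of_injective _ (add_left_injective _)])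
  intro x hx
  obtain ⟨y, hy, rfl⟩ := mem_image.1 hx
  rw [mem_sumset₃] at hy ⊢
  obtain ⟨a', ha', b', hb', c, hc, rfl⟩ := hy
  refine ⟨a', ha', b', hb', c + c₀, ?_, by abel⟩
  rw [← hX]; exact mem_image_of_mem _ hc

/-- **Shape `(1,1 | 1,1 | q+1,q−1)` with periodic `U`-parts at `c₀ ≠ 0`: `A = ⟨g⟩ ∪ (c₀ + ⟨g⟩)`**
(`g = (s'+t) − (s+t')`; proof of `two_cosets_of_law_shape_two` with `near_tiling_two_periodic`). [folklore] -/
theorem quot_cyclic_of_law_shape_two (hρρ : ∀ a b, ρ a * ρ b = ρ (a + b)) (hρτ : ∀ a b, ρ a * τ b = τ (b - a))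
    (hτρ : ∀ a b, τ a * ρ b = τ (a + b)) (hττ : ∀ a b, τ a * τ b = ρ (c₀ + b - a))
    (hρ : Function.Injective ρ) (hτ : Function.Injective τ) (hne : ∀ a b, ρ a ≠ τ b)
    (h : TripleProductProperty S T U)
    (hs₀ : (univ.filter fun a : A => ρ a ∈ S).card = 1) (hs₁ : (univ.filter fun a : A => τ a ∈ S).card = 1)
    (ht₀ : (univ.filter fun a : A => ρ a ∈ T).card = 1) (ht₁ : (univ.filter fun a : A => τ a ∈ T).card = 1)
    (hu : ((univ.filter fun a : A => ρ a ∈ U).card = (univ.filter fun a : A => τ a ∈ U).card + 2 ∧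
        2 * (univ.filter fun a : A => ρ a ∈ U).card + (univ.filter fun a : A => τ a ∈ U).card = Fintype.card A) ∨
      ((univ.filter fun a : A => τ a ∈ U).card = (univ.filter fun a : A => ρ a ∈ U).card + 2 ∧
        2 * (univ.filter fun a : A => τ a ∈ U).card + (univ.filter fun a : A => ρ a ∈ U).card = Fintype.card A))
    (hc₀ : c₀ ≠ 0)
    (hU₀p : (univ.filter fun a : A => ρ a ∈ U).image (· + c₀) = (univ.filter fun a : A => ρ a ∈ U))
    (hU₁p : (univ.filter fun a : A => τ a ∈ U).image (· + c₀) = (univ.filter fun a : A => τ a ∈ U)) :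
    ∃ g : A, ∀ x : A, x ∈ AddSubgroup.zmultiples g ∨ x + c₀ ∈ AddSubgroup.zmultiples g := by
  have h2c : c₀ + c₀ = 0 := two_c0_eq_zero hρτ hτρ hττ hτ
  set U₀ : Finset A := univ.filter fun a => ρ a ∈ U with hU₀
  set U₁ : Finset A := univ.filter fun a => τ a ∈ U with hU₁
  obtain ⟨s, hsS⟩ := card_eq_one.1 hs₀
  obtain ⟨s', hsS'⟩ := card_eq_one.1 hs₁
  obtain ⟨t, htT⟩ := card_eq_one.1 ht₀
  obtain ⟨t', htT'⟩ := card_eq_one.1 ht₁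
  have ms : ρ s ∈ S := by
    have hm := mem_singleton_self s; rw [← hsS] at hm; exact (mem_filter.1 hm).2
  have ms' : τ s' ∈ S := by
    have hm := mem_singleton_self s'; rw [← hsS'] at hm; exact (mem_filter.1 hm).2
  have mt : ρ t ∈ T := by
    have hm := mem_singleton_self t; rw [← htT] at hm; exact (mem_filter.1 hm).2
  have mt' : τ t' ∈ T := by
    have hm := mem_singleton_self t'; rw [← htT'] at hm; exact (mem_filter.1 hm).2
  have mρs : ∀ a ∈ ({s} : Finset A), ρ a ∈ S := fun a ha => by rw [mem_singleton.1 ha]; exact ms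
  have mτs' : ∀ a ∈ ({s'} : Finset A), τ a ∈ S := fun a ha => by rw [mem_singleton.1 ha]; exact ms'
  have mρt : ∀ a ∈ ({t} : Finset A), ρ a ∈ T := fun a ha => by rw [mem_singleton.1 ha]; exact mt
  have mτt' : ∀ a ∈ ({t'} : Finset A), τ a ∈ T := fun a ha => by rw [mem_singleton.1 ha]; exact mt'
  have mρs_c : ∀ a ∈ ({s} : Finset A), cond false (τ a) (ρ a) ∈ S := mρs
  have mτs'_c : ∀ a ∈ ({s'} : Finset A), cond true (τ a) (ρ a) ∈ S := mτs'
  have mρt_c : ∀ a ∈ ({t} : Finset A), cond false (τ a) (ρ a) ∈ T := mρt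
  have mτt'_c : ∀ a ∈ ({t'} : Finset A), cond true (τ a) (ρ a) ∈ T := mτt'
  have mU₀ : ∀ a ∈ U₀, ρ a ∈ U := fun a ha => (mem_filter.1 ha).2
  have mU₁ : ∀ a ∈ U₁, τ a ∈ U := fun a ha => (mem_filter.1 ha).2
  have mU₀_c : ∀ a ∈ U₀, cond false (τ a) (ρ a) ∈ U := mU₀
  have mU₁_c : ∀ a ∈ U₁, cond true (τ a) (ρ a) ∈ U := mU₁
  have cs := card_sumset' hρρ hττ hρ hτ h
  have d₁ := disjoint_sumset₁' hρρ hρτ hτρ hττ hne h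
  have d₂ := disjoint_sumset₂' hρρ hρτ hτρ hττ hne h
  have d₃ := disjoint_sumset₃' hρρ hρτ hτρ hττ hne h
  -- the four relevant sumsets
  have cY := cs false true false mρs_c mτt'_c mU₀_c   -- |s + t' + U₀| = |U₀|
  have cZ := cs false false true mρs_c mρt_c mU₁_c   -- |s + t + U₁| = |U₁|
  have cX' := cs false true true mρs_c mτt'_c mU₁_c   -- |s + t' + U₁| = |U₁|
  have cZ' := cs true true false mτs'_c mτt'_c mU₀_c  -- |s' + t' + U₀| = |U₀|
  simp only [card_singleton, one_mul] at cY cZ cX' cZ'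
  have hXY := d₁ false mτs' mρt mU₀_c mρs mτt'    -- `X ∩ Y = ∅`
  have hX'Y' := d₁ true mτs' mρt mU₁_c mρs mτt'   -- `Y' ∩ X' = ∅`
  rcases hu with ⟨hcard, hsum⟩ | ⟨hcard, hsum⟩
  · -- triangle 1 tiles: `P = s + t' + U₀`, `P + d = s' + t + U₀`, `C = s + t + U₁`
    have hPimg := image_sumset_pair_shift s t' s' t U₀
    refine ⟨s' + t - (s + t'), near_tiling_two_periodic
      (P := (({s} : Finset A) ×ˢ ({t'} : Finset A) ×ˢ U₀).image fun p : A × A × A => p.1 + p.2.1 + p.2.2)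
      (C := (({s} : Finset A) ×ˢ ({t} : Finset A) ×ˢ U₁).image fun p : A × A × A => p.1 + p.2.1 + p.2.2)
      (d₂ false mρs_c mτt' mU₀ mρs_c mρt mU₁) ?_ ?_ ?_ ?_ ?_ (sumset₃_single_single_periodic s t' hU₀p)
      (sumset₃_single_single_periodic s t hU₁p) hc₀ h2c⟩
    · rw [hPimg]; exact (d₃ false mρs mρt_c mU₁ mτs' mU₀).symm
    · apply eq_univ_of_card
      rw [card_union_of_disjoint (disjoint_union_left.2 ⟨d₂ false mρs_c mτt' mU₀ mρs_c mρt mU₁,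
        by rw [hPimg]; exact (d₃ false mρs mρt_c mU₁ mτs' mU₀).symm⟩),
        card_union_of_disjoint (by rw [hPimg]; exact (hXY).symm), card_image_of_injective _ (add_left_injective _),
        cY, cZ]
      omega
    · rw [disjoint_left]
      intro x hx hx'
      rw [mem_sumset₃] at hx
      obtain ⟨a, ha, b, hb, c₁, hc₁, rfl⟩ := hx
      rw [mem_singleton] at ha hb
      subst a
      subst b
      obtain ⟨y, hy, hyx⟩ := mem_image.1 hx'
      rw [mem_sumset₃] at hy
      obtain ⟨a, ha, b, hb, c₂, hc₂, rfl⟩ := hy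
      rw [mem_singleton] at ha hb
      subst a
      subst b
      -- `z = s + t' + c₁ = s' + t + c₂` lies in `X' ∩ Y'`
      have hz1 : s' + t + c₂ ∈ ((({s'} : Finset A) ×ˢ ({t} : Finset A) ×ˢ U₁).image
          fun p : A × A × A => p.1 + p.2.1 + p.2.2) :=
        mem_sumset₃.2 ⟨s', mem_singleton_self _, t, mem_singleton_self _, c₂, hc₂, rfl⟩
      have hz2 : s' + t + c₂ ∈ ((({s} : Finset A) ×ˢ ({t'} : Finset A) ×ˢ U₁).image
          fun p : A × A × A => p.1 + p.2.1 + p.2.2) :=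
        mem_sumset₃.2 ⟨s, mem_singleton_self _, t', mem_singleton_self _, c₁, hc₁, by
          rw [← sub_eq_zero]; rw [← sub_eq_zero] at hyx
          have e : s + t' + c₁ - (s' + t + c₂) = -(s + t + c₂ + (s' + t - (s + t')) - (s + t + c₁)) := by abel
          rw [e, hyx, neg_zero]⟩
      exact disjoint_left.1 hX'Y' hz1 hz2
    · rw [cY, cZ, hcard]
    · rw [hPimg]; exact hXY.symm
  · -- triangle 2 tiles: `P = s + t' + U₁`, `P + d = s' + t + U₁`, `C = s' + t' + U₀`
    have hPimg := image_sumset_pair_shift s t' s' t U₁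
    refine ⟨s' + t - (s + t'), near_tiling_two_periodic
      (P := (({s} : Finset A) ×ˢ ({t'} : Finset A) ×ˢ U₁).image fun p : A × A × A => p.1 + p.2.1 + p.2.2)
      (C := (({s'} : Finset A) ×ˢ ({t'} : Finset A) ×ˢ U₀).image fun p : A × A × A => p.1 + p.2.1 + p.2.2)
      (d₃ true mρs mτt'_c mU₁ mτs' mU₀) ?_ ?_ ?_ ?_ ?_ (sumset₃_single_single_periodic s t' hU₁p)
      (sumset₃_single_single_periodic s' t' hU₀p) hc₀ h2c⟩
    · rw [hPimg]; exact (d₂ true mτs'_c mτt' mU₀ mτs'_c mρt mU₁).symm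
    · apply eq_univ_of_card
      rw [card_union_of_disjoint (disjoint_union_left.2 ⟨d₃ true mρs mτt'_c mU₁ mτs' mU₀,
        by rw [hPimg]; exact (d₂ true mτs'_c mτt' mU₀ mτs'_c mρt mU₁).symm⟩),
        card_union_of_disjoint (by rw [hPimg]; exact hX'Y'.symm), card_image_of_injective _ (add_left_injective _),
        cX', cZ']
      omega
    · rw [disjoint_left]
      intro x hx hx'
      rw [mem_sumset₃] at hx
      obtain ⟨a, ha, b, hb, c₁, hc₁, rfl⟩ := hx
      rw [mem_singleton] at ha hb
      subst a
      subst b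
      obtain ⟨y, hy, hyx⟩ := mem_image.1 hx'
      rw [mem_sumset₃] at hy
      obtain ⟨a, ha, b, hb, c₂, hc₂, rfl⟩ := hy
      rw [mem_singleton] at ha hb
      subst a
      subst b
      -- `z = s + t' + c₁ = s' + t + c₂` lies in `X ∩ Y`
      have hz1 : s' + t + c₂ ∈ ((({s'} : Finset A) ×ˢ ({t} : Finset A) ×ˢ U₀).image
          fun p : A × A × A => p.1 + p.2.1 + p.2.2) :=
        mem_sumset₃.2 ⟨s', mem_singleton_self _, t, mem_singleton_self _, c₂, hc₂, rfl⟩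
      have hz2 : s' + t + c₂ ∈ ((({s} : Finset A) ×ˢ ({t'} : Finset A) ×ˢ U₀).image
          fun p : A × A × A => p.1 + p.2.1 + p.2.2) :=
        mem_sumset₃.2 ⟨s, mem_singleton_self _, t', mem_singleton_self _, c₁, hc₁, by
          rw [← sub_eq_zero]; rw [← sub_eq_zero] at hyx
          have e : s + t' + c₁ - (s' + t + c₂) = -(s' + t' + c₂ + (s' + t - (s + t')) - (s' + t' + c₁)) := by abel
          rw [e, hyx, neg_zero]⟩
      exact disjoint_left.1 hXY hz1 hz2
    · rw [cX', cZ', hcard]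
    · rw [hPimg]; exact hX'Y'.symm


/-- **Shape `(1,1 | 1,1 | q,q)` is impossible at `c₀ ≠ 0` once the `U`-parts are `c₀`-periodic**: periodic
sets have even size, so `3q + 1 = |A|` would be odd, while `c₀` has order `2`. [folklore] -/
theorem no_law_shape_hole_periodic (hρτ : ∀ a b, ρ a * τ b = τ (b - a))
    (hτρ : ∀ a b, τ a * ρ b = τ (a + b)) (hττ : ∀ a b, τ a * τ b = ρ (c₀ + b - a))
    (hτ : Function.Injective τ)
    (hu : (univ.filter fun a : A => ρ a ∈ U).card = (univ.filter fun a : A => τ a ∈ U).card ∧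
      3 * (univ.filter fun a : A => ρ a ∈ U).card + 1 = Fintype.card A)
    (hc₀ : c₀ ≠ 0)
    (hU₀p : (univ.filter fun a : A => ρ a ∈ U).image (· + c₀) = (univ.filter fun a : A => ρ a ∈ U)) : False := by
  have h2c : c₀ + c₀ = 0 := two_c0_eq_zero hρτ hτρ hττ hτ
  have hev := card_even_of_periodic hU₀p hc₀ h2c
  -- `|A|` is even: `c₀` has additive order `2`
  have hord : addOrderOf c₀ = 2 := by
    refine addOrderOf_eq_prime ?_ hc₀
    rw [two_nsmul, h2c]
  have hA2 : 2 ∣ Fintype.card A := by rw [← hord]; exact addOrderOf_dvd_card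
  omega

/-- **`|A| ≡ 1 (mod 3)`, `c₀ ≠ 0`: a TPP triple with `|S| = |T| = 2` attaining `3|S||T||U| + 8 = 8|A|` forces
`A = ⟨g⟩ ∪ (c₀ + ⟨g⟩)`** (`|A| ≥ 7`). [folklore] -/
theorem quot_cyclic_of_two_two_law
    (hρρ : ∀ a b, ρ a * ρ b = ρ (a + b)) (hρτ : ∀ a b, ρ a * τ b = τ (b - a))
    (hτρ : ∀ a b, τ a * ρ b = τ (a + b)) (hττ : ∀ a b, τ a * τ b = ρ (c₀ + b - a))
    (hρ : Function.Injective ρ) (hτ : Function.Injective τ) (hne : ∀ a b, ρ a ≠ τ b)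
    (hsurj : ∀ g, (∃ a, ρ a = g) ∨ (∃ a, τ a = g)) (hmod : Fintype.card A % 3 = 1) (hA : 7 ≤ Fintype.card A)
    (h : TripleProductProperty S T U) (hS : S.card = 2) (hT : T.card = 2)
    (hV : 3 * (S.card * T.card * U.card) + 8 = 8 * Fintype.card A) (hc₀ : c₀ ≠ 0) :
    ∃ g : A, ∀ x : A, x ∈ AddSubgroup.zmultiples g ∨ x + c₀ ∈ AddSubgroup.zmultiples g := by
  have hV0 := hV
  obtain ⟨h000, h111, h100, h011, h010, h101, h001, h110⟩ := vertex_counting' hρρ hρτ hτρ hττ hρ hτ hne h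
  rw [card_eq_parts' hρ hτ hne hsurj S] at hS hV
  rw [card_eq_parts' hρ hτ hne hsurj T] at hT hV
  rw [card_eq_parts' hρ hτ hne hsurj U] at hV
  set s₀ := (univ.filter fun a : A => ρ a ∈ S).card with hs₀
  set s₁ := (univ.filter fun a : A => τ a ∈ S).card with hs₁
  set t₀ := (univ.filter fun a : A => ρ a ∈ T).card with ht₀
  set t₁ := (univ.filter fun a : A => τ a ∈ T).card with ht₁
  set u₀ := (univ.filter fun a : A => ρ a ∈ U).card with hu₀
  set u₁ := (univ.filter fun a : A => τ a ∈ U).card with hu₁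
  -- `S` and `T` meet both cosets exactly once
  have hsv : s₀ = 0 ∨ s₀ = 1 ∨ s₀ = 2 := by omega
  have htv : t₀ = 0 ∨ t₀ = 1 ∨ t₀ = 2 := by omega
  rcases hsv with hs0 | hs0 | hs0 <;> rcases htv with ht0 | ht0 | ht0 <;>
    · have hs1 : s₁ = 2 - s₀ := by omega
      have ht1 : t₁ = 2 - t₀ := by omega
      rw [hs1, ht1, hs0, ht0] at h000 h111 h100 h011 h010 h101 h001 h110 hV
      norm_num at h000 h111 h100 h011 h010 h101 h001 h110 hV
      first
        | (exfalso; omega)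
        | -- the case `s₀ = s₁ = t₀ = t₁ = 1`
          have hs1' : s₁ = 1 := by omega
          have ht1' : t₁ = 1 := by omega
          have hu3 : (u₀ = u₁ + 2 ∧ 2 * u₀ + u₁ = Fintype.card A) ∨ (u₁ = u₀ + 2 ∧ 2 * u₁ + u₀ = Fintype.card A) ∨
              (u₀ = u₁ ∧ 3 * u₀ + 1 = Fintype.card A) := by omega
          obtain ⟨hU₀p, hU₁p⟩ := parts_periodic_of_two_two_law hρρ hρτ hτρ hττ hρ hτ hne hsurj hmod hA h
            hs0 hs1' ht0 ht1' hV0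
          rcases hu3 with hu | hu | hu
          · exact quot_cyclic_of_law_shape_two hρρ hρτ hτρ hττ hρ hτ hne h hs0 hs1' ht0 ht1' (Or.inl hu) hc₀
              hU₀p hU₁p
          · exact quot_cyclic_of_law_shape_two hρρ hρτ hτρ hττ hρ hτ hne h hs0 hs1' ht0 ht1' (Or.inr hu) hc₀
              hU₀p hU₁p
          · exact (no_law_shape_hole_periodic hρτ hτρ hττ hτ hu hc₀ hU₀p).elim

end DihedralLike

end Summit.MatrixMultiplication.OmegaCensus
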